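import Summits.CriticalPhenomena.PercolationContinuityZ3.Theorems.PercNearOneGluingNoHeavyLowerTailSahiCombTriWAndOrAnd

/-!
# Lattice row atoms for AND-products: conjunctions / disjunctions of section indicators and their K-vector facts

Support file of the one-cut programme (crux `NoHeavyLowerTail`, stmt-CriticalPhenomena-4575; unit `prim-lf-1` gen 45, memo
`FROM-prim-lf-1-gen45-AND-OR3.md`).  For a family `A ⊆ 2^{γ₁ ⊕ δ}` and a first-block point `W` (= `x` or `xᶜ`) the section `A_W = {y | W ⊔ y ∈ A}` is an up-set of
`2^δ`; besides the principal indicators `[W ⊔ y ∈ A]` the OR₃ certificate needs the LATTICE indicators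
`[W⊔y₁ ∈ A ∧ W⊔y₂ ∈ A]` (`iAnd`) and `[W⊔y₁ ∈ A ∨ W⊔y₂ ∈ A]` (`iOr`), written as indicator polynomials.  A K-RECIPE is
`x ↦ p(x) − q(xᶜ)` for two monotone `{0,1}`-valued functions `p ≥ q` (family inclusion); it is a unit K-vector, so two K-recipes have a
non-negative inner product over every intersecting Kleitman shell `P₁` (`sum_krec_mul_nonneg`, via `sum_mul_nonneg_of_unit` of `…AndMaj3`).
Also the family-inclusion facts `iAnd_le_ind`, `ind_le_iAnd`, `iOr_le_ind`, `ind_le_iOr` (pointwise non-negativity of the lattice N-atoms).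
HONEST LABEL: bookkeeping only, complete proofs, std axioms. [this work]
-/

namespace Summit.CriticalPhenomena.PercolationContinuityZ3.Theorems

namespace FiveUpSet

open Finset

variable {β γ₁ δ : Type} [DecidableEq β] [Fintype β] [DecidableEq γ₁] [Fintype γ₁] [DecidableEq δ]

/-! ### Lattice indicators -/

/-- `[W⊔y₁ ∈ A ∧ W⊔y₂ ∈ A]` as an indicator polynomial. [this work] -/
def iAnd (A : Finset (Finset (γ₁ ⊕ δ))) (y₁ y₂ : Finset δ) (W : Finset γ₁) : ℤ :=
  ind A (W.disjSum y₁) * ind A (W.disjSum y₂)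

/-- `[W⊔y₁ ∈ A ∨ W⊔y₂ ∈ A]` as an indicator polynomial. [this work] -/
def iOr (A : Finset (Finset (γ₁ ⊕ δ))) (y₁ y₂ : Finset δ) (W : Finset γ₁) : ℤ :=
  ind A (W.disjSum y₁) + ind A (W.disjSum y₂) - ind A (W.disjSum y₁) * ind A (W.disjSum y₂)

omit [Fintype γ₁] in
/-- An indicator is `0` or `1`. [this work] -/
theorem ind_eq_zero_or_one (A : Finset (Finset (γ₁ ⊕ δ))) (t : Finset (γ₁ ⊕ δ)) : ind A t = 0 ∨ ind A t = 1 := by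
  unfold ind; split_ifs <;> simp

omit [Fintype γ₁] in
/-- `iAnd` is `0` or `1`. [this work] -/
theorem iAnd_eq_zero_or_one (A : Finset (Finset (γ₁ ⊕ δ))) (y₁ y₂ : Finset δ) (W : Finset γ₁) :
    iAnd A y₁ y₂ W = 0 ∨ iAnd A y₁ y₂ W = 1 := by
  unfold iAnd
  rcases ind_eq_zero_or_one A (W.disjSum y₁) with h | h <;> rcases ind_eq_zero_or_one A (W.disjSum y₂) with h' | h' <;>
    simp [h, h']

omit [Fintype γ₁] in
/-- `iOr` is `0` or `1`. [this work] -/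
theorem iOr_eq_zero_or_one (A : Finset (Finset (γ₁ ⊕ δ))) (y₁ y₂ : Finset δ) (W : Finset γ₁) :
    iOr A y₁ y₂ W = 0 ∨ iOr A y₁ y₂ W = 1 := by
  unfold iOr
  rcases ind_eq_zero_or_one A (W.disjSum y₁) with h | h <;> rcases ind_eq_zero_or_one A (W.disjSum y₂) with h' | h' <;>
    simp [h, h']

section mono
variable {A : Finset (Finset (γ₁ ⊕ δ))} (hA : IsUpperSet (A : Set (Finset (γ₁ ⊕ δ))))
include hA

omit [Fintype γ₁] in
/-- `iAnd` is monotone in the first-block point. [this work] -/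
theorem iAnd_mono (y₁ y₂ : Finset δ) {W W' : Finset γ₁} (h : W ⊆ W') : iAnd A y₁ y₂ W ≤ iAnd A y₁ y₂ W' := by
  unfold iAnd
  have h1 := ind_mono_pt hA (disjSum_mono h (le_refl y₁))
  have h2 := ind_mono_pt hA (disjSum_mono h (le_refl y₂))
  have b1 := ind_nonneg_le_one A (W.disjSum y₁); have b2 := ind_nonneg_le_one A (W.disjSum y₂)
  have b3 := ind_nonneg_le_one A (W'.disjSum y₁); have b4 := ind_nonneg_le_one A (W'.disjSum y₂)
  nlinarith [mul_nonneg b3.1 (sub_nonneg.2 h2), mul_nonneg b2.1 (sub_nonneg.2 h1)]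

omit [Fintype γ₁] in
/-- `iOr` is monotone in the first-block point. [this work] -/
theorem iOr_mono (y₁ y₂ : Finset δ) {W W' : Finset γ₁} (h : W ⊆ W') : iOr A y₁ y₂ W ≤ iOr A y₁ y₂ W' := by
  unfold iOr
  have h1 := ind_mono_pt hA (disjSum_mono h (le_refl y₁))
  have h2 := ind_mono_pt hA (disjSum_mono h (le_refl y₂))
  have b1 := ind_nonneg_le_one A (W.disjSum y₁); have b2 := ind_nonneg_le_one A (W.disjSum y₂)
  have b3 := ind_nonneg_le_one A (W'.disjSum y₁); have b4 := ind_nonneg_le_one A (W'.disjSum y₂)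
  nlinarith [mul_nonneg (sub_nonneg.2 b4.2) (sub_nonneg.2 h1), mul_nonneg (sub_nonneg.2 b1.2) (sub_nonneg.2 h2)]

omit [Fintype γ₁] in
/-- Family inclusion: `[y₁ ∈ A_W ∧ y₂ ∈ A_W] ≤ [y ∈ A_W]` when `y₁ ⊆ y` (or `y₂ ⊆ y`). [this work] -/
theorem iAnd_le_ind {y₁ y₂ y : Finset δ} (h : y₁ ⊆ y ∨ y₂ ⊆ y) (W : Finset γ₁) : iAnd A y₁ y₂ W ≤ ind A (W.disjSum y) := by
  unfold iAnd
  have b1 := ind_nonneg_le_one A (W.disjSum y₁); have b2 := ind_nonneg_le_one A (W.disjSum y₂)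
  rcases h with h | h
  · have hm := ind_mono_pt hA (disjSum_mono (le_refl W) h); nlinarith
  · have hm := ind_mono_pt hA (disjSum_mono (le_refl W) h); nlinarith

omit [Fintype γ₁] in
/-- Family inclusion: `[y ∈ A_W] ≤ [y₁ ∈ A_W ∧ y₂ ∈ A_W]` when `y ⊆ y₁` and `y ⊆ y₂`. [this work] -/
theorem ind_le_iAnd {y₁ y₂ y : Finset δ} (h₁ : y ⊆ y₁) (h₂ : y ⊆ y₂) (W : Finset γ₁) : ind A (W.disjSum y) ≤ iAnd A y₁ y₂ W := by
  unfold iAnd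
  have hm1 := ind_mono_pt hA (disjSum_mono (le_refl W) h₁); have hm2 := ind_mono_pt hA (disjSum_mono (le_refl W) h₂)
  rcases ind_eq_zero_or_one A (W.disjSum y) with e | e
  · rw [e]; have := ind_nonneg_le_one A (W.disjSum y₁); have := ind_nonneg_le_one A (W.disjSum y₂); nlinarith
  · rw [e] at hm1 hm2 ⊢
    have := ind_nonneg_le_one A (W.disjSum y₁); have := ind_nonneg_le_one A (W.disjSum y₂); nlinarith

omit [Fintype γ₁] in
/-- Family inclusion: `[y₁ ∈ A_W ∨ y₂ ∈ A_W] ≤ [y ∈ A_W]` when `y₁ ⊆ y` and `y₂ ⊆ y`. [this work] -/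
theorem iOr_le_ind {y₁ y₂ y : Finset δ} (h₁ : y₁ ⊆ y) (h₂ : y₂ ⊆ y) (W : Finset γ₁) : iOr A y₁ y₂ W ≤ ind A (W.disjSum y) := by
  unfold iOr
  have hm1 := ind_mono_pt hA (disjSum_mono (le_refl W) h₁); have hm2 := ind_mono_pt hA (disjSum_mono (le_refl W) h₂)
  have b1 := ind_nonneg_le_one A (W.disjSum y₁); have b2 := ind_nonneg_le_one A (W.disjSum y₂)
  nlinarith [mul_nonneg b1.1 b2.1, mul_nonneg b1.1 (sub_nonneg.2 hm2)]

omit [Fintype γ₁] in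
/-- Family inclusion: `[y ∈ A_W] ≤ [y₁ ∈ A_W ∨ y₂ ∈ A_W]` when `y ⊆ y₁` (or `y ⊆ y₂`). [this work] -/
theorem ind_le_iOr {y₁ y₂ y : Finset δ} (h : y ⊆ y₁ ∨ y ⊆ y₂) (W : Finset γ₁) : ind A (W.disjSum y) ≤ iOr A y₁ y₂ W := by
  unfold iOr
  have b1 := ind_nonneg_le_one A (W.disjSum y₁); have b2 := ind_nonneg_le_one A (W.disjSum y₂)
  rcases h with h | h
  · have hm := ind_mono_pt hA (disjSum_mono (le_refl W) h)
    nlinarith [mul_nonneg (sub_nonneg.2 b1.2) b2.1]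
  · have hm := ind_mono_pt hA (disjSum_mono (le_refl W) h)
    nlinarith [mul_nonneg b1.1 (sub_nonneg.2 b2.2)]

end mono

/-! ### K-recipes: `x ↦ p(x) − q(xᶜ)` -/

/-- The three unit-vector facts for a K-recipe `x ↦ p(x) − q(xᶜ)`: `p, q` monotone `{0,1}`-valued with `q ≤ p`. [this work] -/
theorem krec_facts (p q : Finset γ₁ → ℤ) (hp : ∀ W, p W = 0 ∨ p W = 1) (hq : ∀ W, q W = 0 ∨ q W = 1)
    (hpm : ∀ W W', W ⊆ W' → p W ≤ p W') (hqm : ∀ W W', W ⊆ W' → q W ≤ q W') (hqp : ∀ W, q W ≤ p W) :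
    (∀ x : Finset γ₁, -1 ≤ p x - q xᶜ ∧ p x - q xᶜ ≤ 1) ∧
    (∀ x x' : Finset γ₁, x ⊆ x' → p x - q xᶜ ≤ p x' - q x'ᶜ) ∧
    (∀ x x' : Finset γ₁, x ∪ x' = univ → 0 ≤ (p x - q xᶜ) + (p x' - q x'ᶜ)) := by
  refine ⟨fun x => ?_, fun x x' h => ?_, fun x x' h => ?_⟩
  · rcases hp x with e | e <;> rcases hq xᶜ with e' | e' <;> rw [e, e'] <;> norm_num
  · have h1 := hpm x x' h; have h2 := hqm x'ᶜ xᶜ (compl_subset_compl.2 h); linarith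
  · have hc : xᶜ ⊆ x' := by
      intro a ha; rw [mem_compl] at ha
      have := mem_univ a; rw [← h, mem_union] at this; tauto
    have hc' : x'ᶜ ⊆ x := by
      intro a ha; rw [mem_compl] at ha
      have := mem_univ a; rw [← h, mem_union] at this; tauto
    have h1 := hqp xᶜ; have h2 := hpm xᶜ x' hc; have h3 := hqp x'ᶜ; have h4 := hpm x'ᶜ x hc'
    linarith

section acute
variable {P₁ : Finset (Finset γ₁)} (hP : IsUpperSet (P₁ : Set (Finset γ₁))) (hd : Disjoint P₁ (refl P₁))
  (hcor : ∀ U V : Finset (Finset γ₁), IsUpperSet (U : Set (Finset γ₁)) → IsUpperSet (V : Set (Finset γ₁)) → 0 ≤ corP P₁ U V)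
include hP hd hcor

/-- **Acuteness of two K-recipes** over an intersecting Kleitman shell `P₁`. [this work] -/
theorem sum_krec_mul_nonneg (p q p' q' : Finset γ₁ → ℤ) (hp : ∀ W, p W = 0 ∨ p W = 1) (hq : ∀ W, q W = 0 ∨ q W = 1)
    (hpm : ∀ W W', W ⊆ W' → p W ≤ p W') (hqm : ∀ W W', W ⊆ W' → q W ≤ q W') (hqp : ∀ W, q W ≤ p W)
    (hp' : ∀ W, p' W = 0 ∨ p' W = 1) (hq' : ∀ W, q' W = 0 ∨ q' W = 1)
    (hpm' : ∀ W W', W ⊆ W' → p' W ≤ p' W') (hqm' : ∀ W W', W ⊆ W' → q' W ≤ q' W') (hqp' : ∀ W, q' W ≤ p' W) :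
    0 ≤ ∑ x ∈ P₁, (p x - q xᶜ) * (p' x - q' xᶜ) := by
  obtain ⟨bA, mA, pA⟩ := krec_facts p q hp hq hpm hqm hqp
  obtain ⟨bB, mB, pB⟩ := krec_facts p' q' hp' hq' hpm' hqm' hqp'
  refine sum_mul_nonneg_of_unit hP hd hcor (fun x => p x - q xᶜ) (fun x => p' x - q' xᶜ) ?_ ?_ (fun x _ x' _ h => mA x x' h)
    (fun x _ x' _ h => mB x x' h) (fun x _ x' _ h => pA x x' h) (fun x _ x' _ h => pB x x' h)
  · intro x _; have := bA x; omega
  · intro x _; have := bB x; omega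

end acute

end FiveUpSet

end Summit.CriticalPhenomena.PercolationContinuityZ3.Theorems
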